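import Summits.Langlands.Langlands.Theses.ParityLadder

/-!
# Glue of the layer-2 split of `PrimitiveEvenIrregularAutomorphy` (route ParityLadder, rev 1)

Closes the glue item `stmt-Langlands-29754` of `route-Langlands-ParityLadder`:
`PrimitiveEvenIrregularAutomorphy_of_split :
  EvenArtinAutomorphy → EvenScalarVanishing → EvenMixedHodgeAutomorphy →
    PrimitiveEvenIrregularAutomorphy`.
Pure logic — two excluded middles on the (inlined) dials of the lens-5 node `SenBridgeSplit`
(decomp-langlands, 2026-08-30): «ρ is Hodge–Tate-scalar» and «ρ has finite projective image».
An instance of the dark cell PEirr that is not HT-scalar is `EvenMixedHodgeAutomorphy` (EM);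
an HT-scalar one with infinite projective image is `EvenScalarVanishing` (EV); an HT-scalar one
with finite projective image is `EvenArtinAutomorphy` (EA).  Written by contraposition so that
neither dial has to be restated; certified by the critic against the route of record by `Iff.rfl`
on the three children.  No definitions, no new mathematics.
-/

set_option linter.dupNamespace false -- project-wide option; `Summit.Langlands.Langlands` is the mandated namespace

namespace Summit.Langlands.Langlands.Theorems

open Summit.Langlands.Langlands.Theses in
/-- The glue item `stmt-Langlands-29754` of route ParityLadder (rev 1): the three children
`EvenArtinAutomorphy` (EA), `EvenScalarVanishing` (EV) and `EvenMixedHodgeAutomorphy` (EM) of the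
split of `PrimitiveEvenIrregularAutomorphy` (PEirr) imply the parent.  Proof: by contraposition —
if the conclusion failed for an instance, EM forces the instance to be HT-scalar, then EV forces
its projective image to be finite, and then EA yields the conclusion. -/
theorem PrimitiveEvenIrregularAutomorphy_of_split_proof :
    Summit.Langlands.Langlands.Theses.ParityLadder.PrimitiveEvenIrregularAutomorphy_of_split := by
  intro hA hV hM K _ _ n hcpt hn ℓ _ ι ρ hirr hgeo htw hcell
  by_contra hno
  refine hno (hM K n hcpt hn ℓ ι ρ hirr hgeo htw ⟨hcell, fun hs => ?_⟩)
  refine hno (hV K n hcpt hn ℓ ι ρ hirr hgeo htw ⟨hcell, hs, fun hf => ?_⟩)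
  exact hno (hA K n hcpt hn ℓ ι ρ hirr hgeo htw ⟨hcell, hs, hf⟩)

end Summit.Langlands.Langlands.Theorems
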